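import Summits.BirchSwinnertonDyer.Rank1Residual.X12.O11.RouteUPsiD11
import Summits.BirchSwinnertonDyer.Rank1Residual.X12.O11.RouteUInvMulOmega
import Summits.BirchSwinnertonDyer.Rank1Residual.X12.O11.RouteUBernoulliCertificate
import Mathlib.NumberTheory.LegendreSymbol.QuadraticReciprocity
import Mathlib.NumberTheory.LegendreSymbol.JacobiSymbol
import HarnessLib

/-!
# K12r@3 — the ψ-LAYER of the «3-unit regime» at `p = 3` for a PRIME discriminant: `ψ = (·/q)`,
# the Legendre character modulo an odd prime `q ≠ 3` with values in `ℚ₃` (cell `bsd-print-cfram`,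
# seat p3 g1; template for the classes with `d* ∈ {5, 17, 41, −7}` of P3-UNIT-REGIME-CENSUS;
# crux C1 `CMRamifiedThreeBSD`, stmt-BirchSwinnertonDyer-20371)

HONEST FRAMING (cell `bsd-print-cfram`, run/shared/lean/pub/bsd-print-cfram/, D-0131 (2) print
tier; verbatim in every file of the cell): the cell works the partition leaf
`CornerF ∧ p ramified in the CM field K` (LADDER-BSD row K7r = B13; W-ALL row 12r) in PARTITION
currency — a leaf or a cell counts only when its theorem is in the kernel BY NAME. Nothing here is a
Literature statement, no named fact is introduced, nothing is asserted about BSD; beyond-print: NO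
(Dirichlet-character bookkeeping). This is the `p = 3` twin of bsd-cm's `RouteUPrimePsi` (`p = 7`,
`ψ = χ_{−q}·ω²`); at `3` the Teichmüller character `ω` is quadratic and `ψ` carries NO `ω`-factor:
`ψ = χ_{d*}` with `d*` the representative of the Mordell square class UNRAMIFIED at `3`
(P3-UNIT-REGIME-CENSUS §1), here `d* = q* = ±q` for an odd prime `q ≠ 3`.

What is here (all for `χ : DirichletCharacter ℚ_[p] q` at a PRIME level `q`, `χ ≠ 1`):
* §1 (any `p`) `conductor_invMulOmega_of_prime_level` — `f(χ⁻¹ω) = q·p` for `q ≠ p`, `ω ≠ 1` mod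
  `p` (Kriz–Li's `invMulOmega χ ω`); `primVal_invMulOmega_ne_one_of_prime_level` — hypotheses
  (1b)/(3b) of Thm. 1.20: `(χ⁻¹ω)(a) ≠ 1` whenever `q ∣ a` or `p ∣ a`; `primVal_eq_apply_of_coprime`
  and `primVal_invMulOmega_of_coprime` — `(χ⁻¹ω)(a) = χ⁻¹(a)·ω(a)` at `a` coprime to `qp` (for (3b)
  at the other additive primes).
* §2 (`p = 3`) the Legendre character `χ(a) = (a/q)` mod an odd prime `q ≠ 3`: `≠ 1`, PRIMITIVE,
  `χ·χ = 1`, and — for `q ≡ 1 (mod 4)` — `χ(ℓ) = J(q | ℓ)` at every odd prime `ℓ` (quadratic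
  reciprocity; both sides vanish at `ℓ = q`): exactly the binders `hψ`, `hψ2`, `hψval` of
  `PrintCFram.hss_three_of_sq_twist` / `…_of_mordell_int` with `d = q`; (1a) `χ(3) ≠ 1` from
  `(3/q) = −1`; `χ(a) ≠ 1` for `q ∣ a`.
* §3 (any `p`) `norm_generalizedBernoulli_one_eq_one_of_intCert` — the Bernoulli-unit certificate
  at a level PRIME TO `p` (the case bsd-cm's `RouteU.norm_generalizedBernoulli_one_eq_one_of_cert`
  does not cover: there `ord_p n = 1`): for `χ ≠ 1` mod `n`, `p ∤ n`, INTEGER values `χ(j) = c(j)`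
  and `p ∤ Σ_j c(j)·j`, `‖B_{1,χ}‖_p = 1`; `norm_bernoulliOnePrim_eq_one_of_intCert` (primitive `θ`).
  At `p = 3` the first Bernoulli character `ψ₀⁻¹ε_K` of Thm. 1.20 has level prime to `3` (it is
  `χ_q χ_{d_K}`-type), the second (`ψ₀ω⁻¹`) has `3 ∥` level and uses bsd-cm's certificate.

References: [KrizLi2019] Thm. 1.20 (pp. 7–8), §1.5 (1), §2 (p. 11); [Washington1997] Ch. 3, §5.1,
Thm. 4.2; `X12/O11/RouteUPrimePsi.lean`, `RouteUInvMulOmega.lean`, `RouteUBernoulliCertificate.lean`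
(bsd-cm, the `p = 7` pattern and the generic lemmas reused here).
-/

set_option linter.dupNamespace false
set_option autoImplicit false

noncomputable section

open scoped Classical
open DirichletCharacter Literature.NumberTheory.EllipticCurves.KrizLi2019
  Literature.NumberTheory.LFunctions
  Summit.BirchSwinnertonDyer.Rank1Residual.X12.O11.RouteU

namespace Summit.BirchSwinnertonDyer.BirchSwinnertonDyer.Theorems.PrintCFram

/-! ## §1 `ψ⁻¹ω` for `ψ` of PRIME level `q ∌ p`: conductor `q·p`, values -/

section InvMulOmega

variable {p : ℕ} [hp : Fact p.Prime] {q : ℕ} [hq : Fact q.Prime]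

/-- **`f(χ⁻¹ω) = q·p`** for `χ ≠ 1` of prime level `q ≠ p` and `ω ≠ 1` of level `p`: Kriz–Li's
`invMulOmega χ ω = χ⁻¹↑·ω↑` (level `q·p`) is a product of lifts of characters of the coprime
conductors `q`, `p` (bsd-cm `RouteU.conductor_changeLevel_mul_changeLevel`).
[cite: Washington1997, Ch. 3 (conductor of a product of characters of coprime conductor)]
[cite: KrizLi2019, Thm. 1.20 (p. 7, hypotheses (1) and (3))] -/
theorem conductor_invMulOmega_of_prime_level (hqp : q ≠ p) (χ : DirichletCharacter ℚ_[p] q)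
    (hχ : χ ≠ 1) (ω : DirichletCharacter ℚ_[p] p) (hω : ω ≠ 1) :
    (invMulOmega χ ω).conductor = q * p := by
  haveI : NeZero (q * p) := ⟨mul_ne_zero hq.out.ne_zero hp.out.ne_zero⟩
  have hcχ : χ⁻¹.conductor = q := by rw [conductor_inv, conductor_eq_of_prime_of_ne_one χ hχ]
  have hcω : ω.conductor = p := conductor_eq_of_prime_of_ne_one ω hω
  unfold invMulOmega
  rw [conductor_changeLevel_mul_changeLevel _ _ χ⁻¹ ω
    (by rw [hcχ, hcω]; exact (Nat.coprime_primes hq.out hp.out).mpr hqp), hcχ, hcω]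

/-- **(1b)/(3b) of Thm. 1.20 at a prime level: `(χ⁻¹ω)(a) ≠ 1` whenever `q ∣ a` or `p ∣ a`** (the
primitive character has conductor `q·p`, so its value there is `0`).
[cite: KrizLi2019, Thm. 1.20 (1), (3) (p. 7)] -/
theorem primVal_invMulOmega_ne_one_of_prime_level (hqp : q ≠ p) (χ : DirichletCharacter ℚ_[p] q)
    (hχ : χ ≠ 1) (ω : DirichletCharacter ℚ_[p] p) (hω : ω ≠ 1) {a : ℕ} (ha : q ∣ a ∨ p ∣ a) :
    primVal (invMulOmega χ ω) a ≠ 1 := by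
  apply primVal_ne_one_of_not_coprime
  rw [conductor_invMulOmega_of_prime_level hqp χ hχ ω hω]
  intro hc
  rcases ha with h | h
  · exact hq.out.one_lt.ne' (Nat.dvd_one.mp (hc ▸ Nat.dvd_gcd h (dvd_mul_right q p)))
  · exact hp.out.one_lt.ne' (Nat.dvd_one.mp (hc ▸ Nat.dvd_gcd h (dvd_mul_left p q)))

/-- **`primVal χ a = χ(a)` at `a` coprime to the level** (the primitive character inducing `χ`
agrees with `χ` on the units; Mathlib `changeLevel_primitiveCharacter`).
[cite: KrizLi2019, §2 (p. 11, conventions on primitive characters)] -/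
theorem primVal_eq_apply_of_coprime {n : ℕ} [NeZero n] (χ : DirichletCharacter ℚ_[p] n)
    {a : ℕ} (ha : a.Coprime n) : primVal χ a = χ (a : ZMod n) := by
  unfold primVal
  have hcop : IsCoprime (a : ℤ) (n : ℤ) := Nat.isCoprime_iff_coprime.mpr ha
  have h := changeLevel_eq_cast_of_dvd' χ.primitiveCharacter (conductor_dvd_level χ) hcop
  rw [changeLevel_primitiveCharacter] at h
  have e1 : ((a : ℤ) : ZMod n) = (a : ZMod n) := Int.cast_natCast a
  have e2 : ((a : ℤ) : ZMod χ.conductor) = (a : ZMod χ.conductor) := Int.cast_natCast a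
  rw [e1, e2] at h
  exact h.symm

/-- **The value `(χ⁻¹ω)(a) = χ⁻¹(a)·ω(a)` at `a` coprime to `q·p`** (the primitive value agrees with
the product of the lifted values on the units). For the Legendre `χ` (quadratic) `χ⁻¹ = χ`.
[cite: KrizLi2019, Thm. 1.20 (3) (p. 7)] -/
theorem primVal_invMulOmega_of_coprime (χ : DirichletCharacter ℚ_[p] q)
    (ω : DirichletCharacter ℚ_[p] p) {a : ℕ} (ha : a.Coprime (q * p)) :
    primVal (invMulOmega χ ω) a = χ⁻¹ (a : ZMod q) * ω (a : ZMod p) := by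
  haveI : NeZero (q * p) := ⟨mul_ne_zero hq.out.ne_zero hp.out.ne_zero⟩
  rw [primVal_eq_apply_of_coprime _ ha]
  unfold invMulOmega
  have hcop : IsCoprime (a : ℤ) ((q * p : ℕ) : ℤ) := Nat.isCoprime_iff_coprime.mpr ha
  rw [show ((a : ℕ) : ZMod (q * p)) = ((a : ℤ) : ZMod (q * p)) by rw [Int.cast_natCast],
    MulChar.mul_apply, changeLevel_eq_cast_of_dvd' _ _ hcop, changeLevel_eq_cast_of_dvd' _ _ hcop,
    Int.cast_natCast, Int.cast_natCast]

end InvMulOmega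

/-! ## §2 The Legendre character mod an odd prime `q ≠ 3` with values in `ℚ₃` -/

section Legendre

variable {q : ℕ} [hq : Fact q.Prime] (χ : DirichletCharacter ℚ_[3] q)
  (hχ : ∀ a : ℕ, χ (a : ZMod q) = (legendreSym q (a : ℤ) : ℚ_[3]))

include hχ

/-- `χ ≠ 1`: an odd prime has a quadratic non-residue. [cite: Washington1997, Ch. 3 (the quadratic character of conductor q)] -/
theorem legendreChar_three_ne_one (hq2 : q ≠ 2) : χ ≠ 1 := by
  intro h1
  have hF : ringChar (ZMod q) ≠ 2 := by rw [ZMod.ringChar_zmod_n]; exact hq2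
  obtain ⟨a, ha⟩ := FiniteField.exists_nonsquare hF
  have ha0 : a ≠ 0 := by rintro rfl; exact ha (IsSquare.zero)
  have hval : legendreSym q (a.val : ℤ) = -1 := by
    rw [legendreSym.eq_neg_one_iff]
    have : ((a.val : ℤ) : ZMod q) = a := by rw [Int.cast_natCast, ZMod.natCast_zmod_val]
    rw [this]; exact ha
  have h := hχ a.val
  rw [ZMod.natCast_zmod_val, hval, h1, MulChar.one_apply (Ne.isUnit ha0)] at h
  norm_num at h

/-- **`χ` is PRIMITIVE** (conductor `q`). [cite: KrizLi2019, Thm. 1.20 (p. 7, "ψ … primitive")] -/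
theorem legendreChar_three_isPrimitive (hq2 : q ≠ 2) : χ.IsPrimitive := by
  rw [isPrimitive_def]
  exact conductor_eq_of_prime_of_ne_one χ (legendreChar_three_ne_one χ hχ hq2)

/-- **`χ · χ = 1`** (a quadratic character; the binder `hψ2` of `hss_three_of_sq_twist`).
[cite: Washington1997, Ch. 3] -/
theorem legendreChar_three_mul_self : χ * χ = 1 := by
  refine MulChar.ext fun u => ?_
  have hu : ((u : ZMod q)) = (((u : ZMod q).val : ℕ) : ZMod q) := (ZMod.natCast_zmod_val _).symm
  have hu0 : ((((u : ZMod q).val : ℕ) : ℤ) : ZMod q) ≠ 0 := by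
    rw [Int.cast_natCast, ZMod.natCast_zmod_val]; exact Units.ne_zero u
  rw [MulChar.mul_apply, MulChar.one_apply_coe, hu, hχ, ← Int.cast_mul, ← sq,
    legendreSym.sq_one q hu0, Int.cast_one]

/-- **(1a)/(3a) at the level prime: `χ(a) ≠ 1` for `q ∣ a`** (the value is `0`).
[cite: KrizLi2019, Thm. 1.20 (1), (3) (p. 7)] -/
theorem legendreChar_three_apply_ne_one_of_dvd {a : ℕ} (ha : q ∣ a) : χ (a : ZMod q) ≠ 1 := by
  rw [hχ, (legendreSym.eq_zero_iff q (a : ℤ)).mpr (by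
    rw [Int.cast_natCast]; exact (ZMod.natCast_eq_zero_iff a q).mpr ha), Int.cast_zero]
  exact zero_ne_one

/-- **(1a): `χ(3) ≠ 1` when `(3/q) = −1`** (the census condition `d* ≡ 2 (mod 3)` for `d* = q*`,
`q ≡ ±1 (mod 12)` excluded). [cite: KrizLi2019, Thm. 1.20 (1) (p. 7)] -/
theorem legendreChar_three_apply_three_ne_one (h3 : legendreSym q 3 = -1) :
    χ (3 : ZMod q) ≠ 1 := by
  rw [show (3 : ZMod q) = ((3 : ℕ) : ZMod q) by norm_cast, hχ, show ((3 : ℕ) : ℤ) = 3 by rfl, h3]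
  norm_num

/-- **`χ(ℓ) = J(q | ℓ)` at every odd prime `ℓ`, for `q ≡ 1 (mod 4)`** (quadratic reciprocity; at
`ℓ = q` both sides vanish). This is the binder `hψval` of `PrintCFram.hss_three_of_sq_twist` with
`d = q` (for `W ≅ y² = x³ + q·m²`, `q ≡ 1 (mod 4)`: `d* = q`). [cite: KrizLi2019, §2 (p. 12) and §10.1 (ψ_d)]
[cite: Washington1997, Ch. 3 (quadratic reciprocity for the Kronecker character)] -/
theorem legendreChar_three_apply_prime_eq_jacobiSym (hq1 : q % 4 = 1) {ℓ : ℕ} (hℓ : ℓ.Prime)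
    (hℓ2 : ℓ ≠ 2) : χ (ℓ : ZMod q) = ((jacobiSym (q : ℤ) ℓ : ℤ) : ℚ_[3]) := by
  haveI : Fact ℓ.Prime := ⟨hℓ⟩
  rw [hχ]
  congr 1
  by_cases hℓq : ℓ = q
  · subst hℓq
    rw [(legendreSym.eq_zero_iff ℓ (ℓ : ℤ)).mpr (by simp), eq_comm, jacobiSym.eq_zero_iff]
    exact ⟨hℓ.ne_zero, by simp [hℓ.one_lt.ne']⟩
  · rw [← jacobiSym.legendreSym.to_jacobiSym, legendreSym.quadratic_reciprocity_one_mod_four hq1 hℓ2]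

end Legendre

/-! ## §3 The Bernoulli-unit certificate at a level PRIME TO `p` -/

section BernoulliCoprime

variable {p : ℕ} [hp : Fact p.Prime]

/-- `‖k‖_p = 1` for an integer `k` not divisible by `p`. [folklore] -/
private theorem norm_intCast_eq_one_of_not_dvd {k : ℤ} (h : ¬ (p : ℤ) ∣ k) : ‖(k : ℚ_[p])‖ = 1 :=
  le_antisymm (Padic.norm_int_le_one k) (not_lt.mp fun hlt => h (Padic.norm_intCast_lt_one_iff.mp hlt))

/-- **The certificate at a level prime to `p`.** Let `χ ≠ 1` be a Dirichlet character modulo `n`,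
`p ∤ n`, with INTEGER values `χ(j) = c(j)`, and suppose `p ∤ S`, `S = Σ_{j mod n} c(j)·j`. Then
`B_{1,χ} = S/n` (Kriz–Li (1)) is a `p`-adic unit: `‖B_{1,χ}‖_p = 1`. (bsd-cm's certificate
`RouteU.norm_generalizedBernoulli_one_eq_one_of_cert` is the complementary case `ord_p n = 1`.)
[cite: KrizLi2019, §1.5 display (1) (p. 7)] [cite: Washington1997, Thm. 4.2 and §5.1] -/
theorem norm_generalizedBernoulli_one_eq_one_of_intCert {n : ℕ} [NeZero n]
    (χ : DirichletCharacter ℚ_[p] n) (hχ : χ ≠ 1) (hn : ¬ p ∣ n) (c : ZMod n → ℤ)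
    (hc : ∀ j : ZMod n, χ j = (c j : ℚ_[p]))
    (hS : ¬ (p : ℤ) ∣ ∑ j : ZMod n, c j * (j.val : ℤ)) :
    ‖generalizedBernoulli 1 χ‖ = 1 := by
  rw [generalizedBernoulli_one_eq_sum_div χ hχ]
  have hT : (∑ j : ZMod n, χ j * (j.val : ℚ_[p])) =
      ((∑ j : ZMod n, c j * (j.val : ℤ) : ℤ) : ℚ_[p]) := by
    push_cast
    exact Finset.sum_congr rfl fun j _ => by rw [hc j]
  rw [hT, norm_div, norm_intCast_eq_one_of_not_dvd hS]
  have hn1 : ‖(n : ℚ_[p])‖ = 1 := Padic.norm_natCast_eq_one_iff.mpr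
    ((Nat.Prime.coprime_iff_not_dvd hp.out).mpr hn)
  rw [hn1, div_one]

/-- The same in the fact's currency `bernoulliOnePrim`, for a PRIMITIVE `θ` (level prime to `p`).
[cite: KrizLi2019, §1.5 display (1) (p. 7), Thm. 1.20 (p. 8)] -/
theorem norm_bernoulliOnePrim_eq_one_of_intCert {n : ℕ} [NeZero n]
    (θ : DirichletCharacter ℚ_[p] n) (hθ : θ.IsPrimitive) (hθ1 : θ ≠ 1) (hn : ¬ p ∣ n)
    (c : ZMod n → ℤ) (hc : ∀ j : ZMod n, θ j = (c j : ℚ_[p]))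
    (hS : ¬ (p : ℤ) ∣ ∑ j : ZMod n, c j * (j.val : ℤ)) :
    ‖bernoulliOnePrim θ‖ = 1 := by
  rw [bernoulliOnePrim_eq_of_isPrimitive θ hθ]
  exact norm_generalizedBernoulli_one_eq_one_of_intCert θ hθ1 hn c hc hS

end BernoulliCoprime

end Summit.BirchSwinnertonDyer.BirchSwinnertonDyer.Theorems.PrintCFram

end
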